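import Summits.QuantumFields.YangMills.Theorems.RandomisedStokesChaosArithmetic

/-!
# Route `RandomisedStokes` (LINE 18 of seat `ym-r3-idea-2`; rung R3 of LADDER-YM = `T3YM3TorusStatement.YM3TorusSU2`, a RECORD
# rung — not d = 4, not the Clay statement) — THE OFF-SLIVER ENGINE of the glue `HistoryTailOfChaosL` (support item
# stmt-QuantumFields-23887), part 2: the off-sliver per-plaquette tail from `RectangleTailL` and `ChaosSuppressedDominationL`

OFF THE SLIVER `(j+1)^N ≤ p(g_h)` (`h = K − j`; `p = p_{b₀,p₀}`, `b₀ ≥ 1`, `p₀ ≥ N`), for one family `F` and one coupling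
`0 < γ ≤ 1`, the BARE event `{θ_{b₀}(h) ≤ |Ū^{j}(∂p) − 1|}` has Gibbs mass
`≤ (288·C·R^{A+2}·L^{3m} + C'·e^{M})·β_h^{A+3+A'}·exp(−p_{1,1}(g_h)²)` GIVEN the rectangle tail (`RectangleTailL`, constants
`α, c, C, A`) and the chaos bound (`ChaosSuppressedDominationL`, constants `D, R, α_X, c', C', A'`) for `F` at `γ`, thresholds `θ_{b₀} ≤ 2`,
and a profile floor `b₀` large enough for the two exponent comparisons of part 1a (`N > 3/2 + 1/α`, `N > 1 + 1/α_X`).  With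
`η = θ/(2D(j+1))`: part 1b's split + rectangle count + one-rectangle bound give the rectangle term
`288R²L^{3m}(j+1)L^{3K+2j} · Cβ_K^A(RL^j)^A e^{−κ₁(j+1) − u²} ≤ 288CR^{A+2}L^{3m}β_h^{A+3}e^{−u²}` (`term1_le`:
`(j+1)L^{(5+2A)j} ≤ e^{κ₁(j+1)}`, `κ₁ = 1 + (5+2A)log L`), and the chaos crux at `η/g_h² = p·e^{ℓ}/(2D(j+1))` gives
`C'β_K^{A'}e^{−Y} ≤ C'e^{M}β_h^{A'}e^{−u²}` (`term2_le`, `u = 1 + ℓ`, `ℓ = log g_h⁻¹`).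

HONEST FRAMING: bookkeeping only, with the two cruxes as HYPOTHESES; nothing here proves them, `HistoryTailL`, the rung R3, or anything
about the Yang–Mills mass gap.  No `def`, no `sorry`.

References: T. Bałaban, CMP **102** (1985) 255–275 [Balaban1985UV3] ((3),(7) p.256–257); C. King, CMP **103** (1986) 323–349 [King1986].
-/

set_option autoImplicit false

noncomputable section

open MeasureTheory
open scoped BigOperators
open Literature.MathematicalPhysics.QuantumFieldTheory.Balaban1983to89
open Literature.MathematicalPhysics.QuantumFieldTheory.Balaban1983to89.T3ContinuumYM3Torus
open Literature.MathematicalPhysics.QuantumFieldTheory.Balaban1983to89.T3UnitScaleTilt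
open Literature.MathematicalPhysics.QuantumFieldTheory.Balaban1983to89.T3Thresholds
open Literature.MathematicalPhysics.QuantumFieldTheory.Balaban1983to89.T3ThresholdSmallness (sqrt_coupling_pos_le)
open Summit.QuantumFields.YangMills.Theorems.RectangleDominationShallow

namespace Summit.QuantumFields.YangMills.Theorems.RandomisedStokesChaos

/-! ## §1 The two terms after the exponent comparisons -/

section Terms

/-- **THE RECTANGLE TERM**: `(288R²L^{3m}·(j+1)(L^K)³(L^j)²)·(C·β_K^A(RL^j)^A·e^{−(κ₁(j+1)+u²)}) ≤ 288·C·R^{A+2}·L^{3m}·β_h^{A+3}·e^{−u²}`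
with `κ₁ = 1 + (5+2A)·log L`, `β_K = L^j β_h`, `L^h ≤ β_h` (`0 < γ ≤ 1`): the `j`-entropy `(j+1)·L^{(5+2A)j} ≤ e^{κ₁(j+1)}` is paid by
the exponent. [cite: Balaban1985UV3, (3) p.256] -/
theorem term1_le (F : T3Family) {K j h A : ℕ} {γ C R u : ℝ} (hKjh : K = j + h) (hγ : 0 < γ) (hγ1 : γ ≤ 1)
    (hC : 0 ≤ C) (hR : 2 ≤ R) :
    (288 * R ^ 2 * (F.L : ℝ) ^ (3 * F.m) * (((j : ℝ) + 1) * ((F.L : ℝ) ^ K) ^ 3 * ((F.L : ℝ) ^ j) ^ 2)) *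
        (C * (γ * ((F.L : ℝ)⁻¹) ^ K)⁻¹ ^ A * (R * (F.L : ℝ) ^ j) ^ A *
          Real.exp (-((1 + (5 + 2 * (A : ℝ)) * Real.log F.L) * ((j : ℝ) + 1) + u ^ 2))) ≤
      288 * C * R ^ (A + 2) * (F.L : ℝ) ^ (3 * F.m) * ((γ * ((F.L : ℝ)⁻¹) ^ h)⁻¹) ^ (A + 3) * Real.exp (-(u ^ 2)) := by
  have hL1 : 1 ≤ F.L := F.hL.2.le
  have hLr1 : (1 : ℝ) ≤ F.L := by exact_mod_cast hL1
  have hLr0 : (0 : ℝ) < F.L := by linarith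
  have hR0 : 0 < R := by linarith
  set β : ℝ := (γ * ((F.L : ℝ)⁻¹) ^ h)⁻¹ with hβ_def
  have hβ1 : 1 ≤ β := one_le_beta hL1 hγ hγ1 h
  have hβ0 : 0 < β := one_pos.trans_le hβ1
  have hLhβ : (F.L : ℝ) ^ h ≤ β := pow_le_beta hL1 hγ hγ1 h
  have hβK : (γ * ((F.L : ℝ)⁻¹) ^ K)⁻¹ = (F.L : ℝ) ^ j * β := by
    have := beta_eq_pow_mul hL1 γ (K := K) (j := j) (by omega)
    rwa [show K - j = h by omega] at this
  -- the `j`-entropy: `(j+1)·(L^j)^{5+2A} ≤ e^{κ₁(j+1)}`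
  have hent : ((j : ℝ) + 1) * ((F.L : ℝ) ^ j) ^ (5 + 2 * A) ≤
      Real.exp ((1 + (5 + 2 * (A : ℝ)) * Real.log F.L) * ((j : ℝ) + 1)) := by
    have h1 : ((j : ℝ) + 1) ≤ Real.exp ((j : ℝ) + 1) :=
      (Real.add_one_le_exp (j : ℝ)).trans (Real.exp_le_exp.mpr (by linarith))
    have h2 : ((F.L : ℝ) ^ j) ^ (5 + 2 * A) = Real.exp (((j * (5 + 2 * A) : ℕ) : ℝ) * Real.log F.L) := by
      rw [← pow_mul, Real.exp_nat_mul, Real.exp_log hLr0]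
    have h3 : (((j * (5 + 2 * A) : ℕ) : ℝ) * Real.log F.L) ≤ ((j : ℝ) + 1) * (5 + 2 * (A : ℝ)) * Real.log F.L := by
      have hlog0 : 0 ≤ Real.log F.L := Real.log_nonneg hLr1
      push_cast
      nlinarith
    calc ((j : ℝ) + 1) * ((F.L : ℝ) ^ j) ^ (5 + 2 * A)
        ≤ Real.exp ((j : ℝ) + 1) * Real.exp (((j : ℝ) + 1) * (5 + 2 * (A : ℝ)) * Real.log F.L) := by
          rw [h2]
          exact mul_le_mul h1 (Real.exp_le_exp.mpr h3) (Real.exp_nonneg _) (Real.exp_nonneg _)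
      _ = Real.exp ((1 + (5 + 2 * (A : ℝ)) * Real.log F.L) * ((j : ℝ) + 1)) := by
          rw [← Real.exp_add]; ring_nf
  -- rewrite everything in terms of `L^j` and `β`
  have hLK3 : ((F.L : ℝ) ^ K) ^ 3 ≤ ((F.L : ℝ) ^ j) ^ 3 * β ^ 3 := by
    rw [hKjh, pow_add, mul_pow]
    exact mul_le_mul_of_nonneg_left (pow_le_pow_left₀ (by positivity) hLhβ 3) (by positivity)
  have hexp_split : Real.exp (-((1 + (5 + 2 * (A : ℝ)) * Real.log F.L) * ((j : ℝ) + 1) + u ^ 2)) =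
      Real.exp (-((1 + (5 + 2 * (A : ℝ)) * Real.log F.L) * ((j : ℝ) + 1))) * Real.exp (-(u ^ 2)) := by
    rw [← Real.exp_add]; ring_nf
  have hent' : ((j : ℝ) + 1) * ((F.L : ℝ) ^ j) ^ (5 + 2 * A) *
      Real.exp (-((1 + (5 + 2 * (A : ℝ)) * Real.log F.L) * ((j : ℝ) + 1))) ≤ 1 := by
    rw [Real.exp_neg]
    have hE := Real.exp_pos ((1 + (5 + 2 * (A : ℝ)) * Real.log F.L) * ((j : ℝ) + 1))
    rw [mul_inv_le_iff₀ hE, one_mul]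
    exact hent
  rw [hβK, hexp_split]
  have hLj0 : (0 : ℝ) ≤ (F.L : ℝ) ^ j := by positivity
  -- the main inequality, as `X · Y ≤ X' · 1` after regrouping
  have hkey : (((j : ℝ) + 1) * ((F.L : ℝ) ^ K) ^ 3 * ((F.L : ℝ) ^ j) ^ 2) * (((F.L : ℝ) ^ j * β) ^ A * ((F.L : ℝ) ^ j) ^ A *
      Real.exp (-((1 + (5 + 2 * (A : ℝ)) * Real.log F.L) * ((j : ℝ) + 1)))) ≤ β ^ (A + 3) := by
    calc (((j : ℝ) + 1) * ((F.L : ℝ) ^ K) ^ 3 * ((F.L : ℝ) ^ j) ^ 2) * (((F.L : ℝ) ^ j * β) ^ A * ((F.L : ℝ) ^ j) ^ A *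
          Real.exp (-((1 + (5 + 2 * (A : ℝ)) * Real.log F.L) * ((j : ℝ) + 1))))
        ≤ (((j : ℝ) + 1) * (((F.L : ℝ) ^ j) ^ 3 * β ^ 3) * ((F.L : ℝ) ^ j) ^ 2) * (((F.L : ℝ) ^ j * β) ^ A *
          ((F.L : ℝ) ^ j) ^ A * Real.exp (-((1 + (5 + 2 * (A : ℝ)) * Real.log F.L) * ((j : ℝ) + 1)))) := by
          refine mul_le_mul_of_nonneg_right (mul_le_mul_of_nonneg_right
            (mul_le_mul_of_nonneg_left hLK3 (by positivity)) (by positivity)) (by positivity)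
      _ = β ^ (A + 3) * (((j : ℝ) + 1) * ((F.L : ℝ) ^ j) ^ (5 + 2 * A) *
          Real.exp (-((1 + (5 + 2 * (A : ℝ)) * Real.log F.L) * ((j : ℝ) + 1)))) := by ring
      _ ≤ β ^ (A + 3) * 1 := mul_le_mul_of_nonneg_left hent' (by positivity)
      _ = β ^ (A + 3) := mul_one _
  calc (288 * R ^ 2 * (F.L : ℝ) ^ (3 * F.m) * (((j : ℝ) + 1) * ((F.L : ℝ) ^ K) ^ 3 * ((F.L : ℝ) ^ j) ^ 2)) *
        (C * ((F.L : ℝ) ^ j * β) ^ A * (R * (F.L : ℝ) ^ j) ^ A *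
          (Real.exp (-((1 + (5 + 2 * (A : ℝ)) * Real.log F.L) * ((j : ℝ) + 1))) * Real.exp (-(u ^ 2))))
      = (288 * C * R ^ (A + 2) * (F.L : ℝ) ^ (3 * F.m) * Real.exp (-(u ^ 2))) *
          ((((j : ℝ) + 1) * ((F.L : ℝ) ^ K) ^ 3 * ((F.L : ℝ) ^ j) ^ 2) * (((F.L : ℝ) ^ j * β) ^ A * ((F.L : ℝ) ^ j) ^ A *
            Real.exp (-((1 + (5 + 2 * (A : ℝ)) * Real.log F.L) * ((j : ℝ) + 1))))) := by rw [mul_pow R]; ring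
    _ ≤ (288 * C * R ^ (A + 2) * (F.L : ℝ) ^ (3 * F.m) * Real.exp (-(u ^ 2))) * β ^ (A + 3) :=
        mul_le_mul_of_nonneg_left hkey (by positivity)
    _ = 288 * C * R ^ (A + 2) * (F.L : ℝ) ^ (3 * F.m) * β ^ (A + 3) * Real.exp (-(u ^ 2)) := by ring

/-- **THE CHAOS TERM**: if `A'·j·log L + u² ≤ Y + M` then `C'·β_K^{A'}·e^{−Y} ≤ C'·e^{M}·β_h^{A'}·e^{−u²}` (`β_K = L^j β_h`,
`(L^j)^{A'} = e^{A' j log L}`). [cite: Balaban1985UV3, (3) p.256] -/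
theorem term2_le (F : T3Family) {K j h A' : ℕ} {γ C' Y M u : ℝ} (hKjh : K = j + h) (hγ : 0 < γ) (hC' : 0 ≤ C')
    (hY : (A' : ℝ) * ((j : ℝ) * Real.log F.L) + u ^ 2 ≤ Y + M) :
    C' * (γ * ((F.L : ℝ)⁻¹) ^ K)⁻¹ ^ A' * Real.exp (-Y) ≤
      C' * Real.exp M * ((γ * ((F.L : ℝ)⁻¹) ^ h)⁻¹) ^ A' * Real.exp (-(u ^ 2)) := by
  have hL1 : 1 ≤ F.L := F.hL.2.le
  have hLr0 : (0 : ℝ) < F.L := by exact_mod_cast (lt_of_lt_of_le one_pos hL1)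
  have hβK : (γ * ((F.L : ℝ)⁻¹) ^ K)⁻¹ = (F.L : ℝ) ^ j * (γ * ((F.L : ℝ)⁻¹) ^ h)⁻¹ := by
    have := beta_eq_pow_mul hL1 γ (K := K) (j := j) (by omega)
    rwa [show K - j = h by omega] at this
  have hβ0 : 0 ≤ (γ * ((F.L : ℝ)⁻¹) ^ h)⁻¹ := by positivity
  have hLj : ((F.L : ℝ) ^ j) ^ A' = Real.exp ((A' : ℝ) * ((j : ℝ) * Real.log F.L)) := by
    rw [← pow_mul, ← Real.exp_log hLr0, ← Real.exp_nat_mul, Real.exp_log hLr0]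
    push_cast
    ring_nf
  have hexp : ((F.L : ℝ) ^ j) ^ A' * Real.exp (-Y) ≤ Real.exp M * Real.exp (-(u ^ 2)) := by
    rw [hLj, ← Real.exp_add, ← Real.exp_add]
    exact Real.exp_le_exp.mpr (by linarith)
  rw [hβK, mul_pow]
  calc C' * (((F.L : ℝ) ^ j) ^ A' * (γ * ((F.L : ℝ)⁻¹) ^ h)⁻¹ ^ A') * Real.exp (-Y)
      = C' * (γ * ((F.L : ℝ)⁻¹) ^ h)⁻¹ ^ A' * (((F.L : ℝ) ^ j) ^ A' * Real.exp (-Y)) := by ring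
    _ ≤ C' * (γ * ((F.L : ℝ)⁻¹) ^ h)⁻¹ ^ A' * (Real.exp M * Real.exp (-(u ^ 2))) :=
        mul_le_mul_of_nonneg_left hexp (by positivity)
    _ = C' * Real.exp M * ((γ * ((F.L : ℝ)⁻¹) ^ h)⁻¹) ^ A' * Real.exp (-(u ^ 2)) := by ring

end Terms

/-! ## §2 The off-sliver per-plaquette tail -/

section OffSliver

/-- **THE OFF-SLIVER PER-PLAQUETTE TAIL** (one family `F`, one coupling `0 < γ ≤ 1`; `j ≤ K`, depth `h = K − j`, OFF the sliver:
`(j+1)^N ≤ p_{b₀,p₀}(g_h)`).  Given the rectangle tail (`RectangleTailL`: `α, c, C, A`) and the chaos bound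
(`ChaosSuppressedDominationL`: `D, R, α_X, c', C', A'`) for `F` at `γ`, thresholds `θ_{b₀}(·) ≤ 2`, and a profile with `b₀ ≥ 1`,
`p₀ ≥ N` whose floor passes the two exponent comparisons of part 1a, the BARE event `{θ_{b₀}(h) ≤ |Ū^{j}(∂p) − 1|}` has Gibbs mass
`≤ (288·C·R^{A+2}·L^{3m} + C'·e^{M})·β_h^{A+3+A'}·exp(−1·p_{1,1}(g_h)²)`, `M = 2 + 8/κ₃²`.  Proof: `η = θ/(2D(j+1)) ≤ 1`;
split (`real_bare_le_count_mul_add`); rectangles (`rect_event_le_offSliver`, `count_le_offSliver`, `term1_le`); chaos (`η/g_h² =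
p e^{ℓ}/(2D(j+1))`, `offSliver_chaos_exponent`, `term2_le`). [cite: Balaban1985UV3, (7) p.257] -/
theorem offSliver_perPlaquette (F : T3Family) {γ α c C D R αX c' C' b₀ p₀ : ℝ} {A A' N : ℕ}
    (hγ : 0 < γ) (hγ1 : γ ≤ 1) (hα : 0 < α) (hc : 0 < c) (hC : 0 ≤ C) (hD : 1 ≤ D) (hR : 2 ≤ R)
    (hαX : 0 < αX) (hc' : 0 < c') (hC' : 0 ≤ C') (hb₀1 : 1 ≤ b₀) (hN : 0 < N) (hNp : (N : ℝ) ≤ p₀)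
    (hδ1 : 0 ≤ α * (2 - 3 / N) - 2 / N) (hδ2 : 0 ≤ αX * (1 - 1 / N) - 1 / N)
    (hbig1 : (1 + (5 + 2 * (A : ℝ)) * Real.log F.L) + 1 ≤
      (c / (4 * D ^ 2 * R * (1 + Real.log R) * (1 + Real.log F.L))) ^ α * b₀ ^ (α * (2 - 3 / N) - 2 / N))
    (hbig2 : (A' : ℝ) * Real.log F.L ≤ (c' / (2 * D)) ^ αX / 2 * b₀ ^ (αX * (1 - 1 / N) - 1 / N))
    (hRT : ∀ (K a b : ℕ) (x : Site (F.P K) 0) (μ ν : Fin (F.P K).d) (t : ℝ), μ ≠ ν → 1 ≤ a → 1 ≤ b →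
      2 * (a + b) < (F.P K).sitesPerDir 0 → 0 < t → t ≤ 1 →
      (gibbsK F T3UnitLawDensityEML.ℰp γ K).real
          {U | t ≤ GaugeGroup.dist1 (Missing.pathHol U (Missing.rectLoop x μ ν a b))} ≤
        C * (F.scheme T3UnitLawDensityEML.ℰp γ).β K ^ A * ((a : ℝ) + b) ^ A *
          Real.exp (-((c * (t ^ 2 * (F.scheme T3UnitLawDensityEML.ℰp γ).β K /
            (((a : ℝ) + b) * (1 + Real.log ((a : ℝ) + b))))) ^ α)))
    (hX : ∀ (K j : ℕ) (q : Plaq (F.P K) j) (η : ℝ), j ≤ K → 0 < η → η ≤ 1 →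
      (gibbsK F T3UnitLawDensityEML.ℰp γ K).real
        {U | (∀ (i a b : ℕ) (x : Site (F.P K) 0) (μ ν : Fin (F.P K).d), μ ≠ ν → i ≤ j → 1 ≤ a → 1 ≤ b →
            2 * (a + b) < (F.P K).sitesPerDir 0 → ((a : ℝ) + b) ≤ R * (F.L : ℝ) ^ i →
            GaugeGroup.dist1 (Missing.pathHol U (Missing.rectLoop x μ ν a b)) ≤
              η * Real.sqrt ((F.L : ℝ) ^ i / (F.L : ℝ) ^ j)) ∧
          D * ((j : ℝ) + 1) * η < GaugeGroup.dist1 (GaugeField.plaqHol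
            (Averaging.iter (fun i => BlockAveraging.blockAvg (P := F.P K) (j := i) T3UnitLawDensityEML.ℰp) j U) q)} ≤
        C' * (F.scheme T3UnitLawDensityEML.ℰp γ).β K ^ A' *
          Real.exp (-((c' * (η / (γ * ((F.L : ℝ)⁻¹) ^ (K - j)))) ^ αX)))
    (hθ2 : ∀ h : ℕ, θBal F.L γ b₀ p₀ h ≤ 2)
    {K j : ℕ} (hjK : j ≤ K) (hoff : ((j : ℝ) + 1) ^ N ≤ B10.pFun b₀ p₀ (Real.sqrt (γ * ((F.L : ℝ)⁻¹) ^ (K - j))))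
    (p : Plaq (F.P K) j) :
    (gibbsK F T3UnitLawDensityEML.ℰp γ K).real
        {U | θBal F.L γ b₀ p₀ (K - j) ≤ GaugeGroup.dist1 (GaugeField.plaqHol
          (Averaging.iter (fun i => BlockAveraging.blockAvg (P := F.P K) (j := i) T3UnitLawDensityEML.ℰp) j U) p)} ≤
      (288 * C * R ^ (A + 2) * (F.L : ℝ) ^ (3 * F.m) +
          C' * Real.exp (2 + 8 / ((c' / (2 * D)) ^ αX / 2 * αX ^ 3 / 6) ^ 2)) *
        ((γ * ((F.L : ℝ)⁻¹) ^ (K - j))⁻¹) ^ (A + 3 + A') *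
        Real.exp (-(1 * B10.pFun 1 1 (Real.sqrt (γ * ((F.L : ℝ)⁻¹) ^ (K - j))) ^ 2)) := by
  haveI := isProbabilityMeasure_gibbsK F T3UnitLawDensityEML.ℰp hγ.le K
  have hL := F.hL
  have hL1 : 1 ≤ F.L := hL.2.le
  have hLr1 : (1 : ℝ) ≤ F.L := by exact_mod_cast hL1
  have hLr0 : (0 : ℝ) < F.L := by linarith
  have hLne : (F.L : ℝ) ≠ 0 := hLr0.ne'
  have hγne : γ ≠ 0 := hγ.ne'
  have hR0 : 0 < R := by linarith
  have hD0 : 0 < D := by linarith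
  have hDne : D ≠ 0 := hD0.ne'
  have hlog0 : 0 ≤ Real.log F.L := Real.log_nonneg hLr1
  have hb₀ : 0 < b₀ := by linarith
  -- depth
  obtain ⟨h, hKjh⟩ : ∃ h, K = j + h := ⟨K - j, by omega⟩
  have hh : K - j = h := by omega
  rw [hh] at hoff
  rw [hh, pFun_one_one, one_mul]
  -- the coupling, its logarithm, the inverse coupling, the profile value
  have hg := sqrt_coupling_pos_le hL1 hγ h
  have hℓ0 : 0 ≤ Real.log (Real.sqrt (γ * ((F.L : ℝ)⁻¹) ^ h))⁻¹ := log_inv_coupling_nonneg hL1 hγ hγ1 h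
  set g : ℝ := Real.sqrt (γ * ((F.L : ℝ)⁻¹) ^ h) with hg_def
  set ℓ : ℝ := Real.log g⁻¹ with hℓ_def
  set β : ℝ := (γ * ((F.L : ℝ)⁻¹) ^ h)⁻¹ with hβ_def
  have hβ1 : 1 ≤ β := one_le_beta hL1 hγ hγ1 h
  have hβ0 : 0 < β := one_pos.trans_le hβ1
  have hPdef : B10.pFun b₀ p₀ g = b₀ * (1 + ℓ) ^ p₀ := rfl
  set P : ℝ := B10.pFun b₀ p₀ g with hP_def
  have hu1 : 1 ≤ 1 + ℓ := by linarith
  have hup1 : 1 ≤ (1 + ℓ) ^ p₀ := Real.one_le_rpow hu1 (by linarith [show (0:ℝ) < N by exact_mod_cast hN])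
  have hPb : b₀ ≤ P := by rw [hPdef]; exact le_mul_of_one_le_right hb₀.le hup1
  have hP1 : 1 ≤ P := hb₀1.trans hPb
  have hP0 : 0 < P := by linarith
  have hNr : (0 : ℝ) < N := by exact_mod_cast hN
  have huP : (1 + ℓ) ^ 2 ≤ P ^ ((2 : ℝ) / N) := by
    have h1 : (1 + ℓ) ^ (N : ℝ) ≤ P := by
      calc (1 + ℓ) ^ (N : ℝ) ≤ (1 + ℓ) ^ p₀ := Real.rpow_le_rpow_of_exponent_le hu1 hNp
        _ ≤ P := by rw [hPdef]; exact le_mul_of_one_le_left (by positivity) hb₀1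
    have h2 := Real.rpow_le_rpow (by positivity) h1 (by positivity : (0 : ℝ) ≤ 2 / N)
    rwa [← Real.rpow_mul (by positivity), mul_div_cancel₀ _ hNr.ne', Real.rpow_two] at h2
  have hbig1' : (1 + (5 + 2 * (A : ℝ)) * Real.log F.L) + 1 ≤
      (c / (4 * D ^ 2 * R * (1 + Real.log R) * (1 + Real.log F.L))) ^ α * P ^ (α * (2 - 3 / N) - 2 / N) :=
    hbig1.trans (mul_le_mul_of_nonneg_left (Real.rpow_le_rpow hb₀.le hPb hδ1) (Real.rpow_nonneg (by
      have : 0 ≤ Real.log R := Real.log_nonneg (by linarith); positivity) α))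
  have hbig2' : (A' : ℝ) * Real.log F.L ≤ (c' / (2 * D)) ^ αX / 2 * P ^ (αX * (1 - 1 / N) - 1 / N) :=
    hbig2.trans (mul_le_mul_of_nonneg_left (Real.rpow_le_rpow hb₀.le hPb hδ2) (by positivity))
  -- the threshold and `η`
  have hθ0 : 0 < θBal F.L γ b₀ p₀ h := T3MinimiserStabilityReduction.θBal_pos hL1 hγ hγ1 hb₀ p₀ h
  have hθ2' := hθ2 h
  set θ : ℝ := θBal F.L γ b₀ p₀ h with hθ_def
  have hθg : θ = g * P := rfl
  have hj1 : (0 : ℝ) < (j : ℝ) + 1 := by positivity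
  set η : ℝ := θ / (2 * D * ((j : ℝ) + 1)) with hη_def
  have hη0 : 0 < η := by positivity
  have hη1 : η ≤ 1 := by
    rw [hη_def, div_le_one (by positivity)]
    calc θ ≤ 2 := hθ2'
      _ = 2 * 1 * 1 := by ring
      _ ≤ 2 * D * ((j : ℝ) + 1) := mul_le_mul (mul_le_mul_of_nonneg_left hD (by norm_num)) (by linarith)
          zero_le_one (by positivity)
  have hDη : D * ((j : ℝ) + 1) * η = θ / 2 := by rw [hη_def]; field_simp
  have hθη : D * ((j : ℝ) + 1) * η < θ := by rw [hDη]; linarith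
  -- the identities `η²β_K = P²L^j/(4D²(j+1)²)` and `η/g_h² = P·e^ℓ/(2D(j+1))`
  have hg2 : g ^ 2 = γ * ((F.L : ℝ)⁻¹) ^ h := Real.sq_sqrt (by positivity)
  have hηβ : η ^ 2 * (γ * ((F.L : ℝ)⁻¹) ^ K)⁻¹ = P ^ 2 * (F.L : ℝ) ^ j / (4 * D ^ 2 * ((j : ℝ) + 1) ^ 2) := by
    have hLj0 : (F.L : ℝ) ^ j ≠ 0 := pow_ne_zero j hLne
    have hLh0 : (F.L : ℝ) ^ h ≠ 0 := pow_ne_zero h hLne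
    rw [hη_def, hθg, div_pow, mul_pow, hg2, hKjh, pow_add]
    simp only [inv_pow]
    field_simp
    norm_num
  have hηg : η / (γ * ((F.L : ℝ)⁻¹) ^ h) = P * Real.exp ℓ / (2 * D * ((j : ℝ) + 1)) := by
    have hexpℓ : Real.exp ℓ = g⁻¹ := by rw [hℓ_def, Real.exp_log (inv_pos.mpr hg.1)]
    have hgne : g ≠ 0 := hg.1.ne'
    rw [hexpℓ, ← hg2, hη_def, hθg]
    field_simp
  -- the rectangle part
  set κ₁ : ℝ := 1 + (5 + 2 * (A : ℝ)) * Real.log F.L with hκ₁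
  have hκ₁0 : 0 ≤ κ₁ := by positivity
  have hβKdef : (F.scheme T3UnitLawDensityEML.ℰp γ).β K = (γ * ((F.L : ℝ)⁻¹) ^ K)⁻¹ := rfl
  have hB0 : 0 ≤ C * (γ * ((F.L : ℝ)⁻¹) ^ K)⁻¹ ^ A * (R * (F.L : ℝ) ^ j) ^ A *
      Real.exp (-(κ₁ * ((j : ℝ) + 1) + (1 + ℓ) ^ 2)) := by positivity
  have hsplit := real_bare_le_count_mul_add F p (gibbsK F T3UnitLawDensityEML.ℰp γ K) hR0.le hB0 hθη
    (fun i a b x μ ν hμν hij ha hb hab habR => rect_event_le_offSliver F x μ ν (gibbsK F T3UnitLawDensityEML.ℰp γ K)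
      hγ hα hc hC hD hR hP1 hN hoff huP hκ₁0 hbig1' hη0 hη1 hηβ
      (fun a b x μ ν t hμν ha hb hab ht0 ht1 => by
        have := hRT K a b x μ ν t hμν ha hb hab ht0 ht1; rwa [hβKdef] at this) hμν hij ha hb hab habR)
  -- the chaos part
  have hchaos := hX K j p η hjK hη0 hη1
  rw [hh, hηg, hβKdef] at hchaos
  have hY := offSliver_chaos_exponent (logL := Real.log F.L) (A' := (A' : ℝ)) hαX hc' hD hP1 hN hoff hℓ0 hlog0
    (Nat.cast_nonneg A') hbig2'
  -- the two terms
  have h1 := term1_le F (u := 1 + ℓ) (A := A) hKjh hγ hγ1 hC hR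
  have h2 := term2_le F hKjh hγ hC' hY
  have hcount := count_le_offSliver F (K := K) (j := j) hR
  refine hsplit.trans ((add_le_add le_rfl hchaos).trans ?_)
  have hsum : (((j + 1) * (Fintype.card (Site (F.P K) 0) *
        (3 * (3 * ((⌊R * (F.L : ℝ) ^ j⌋₊ + 1) * (⌊R * (F.L : ℝ) ^ j⌋₊ + 1))))) : ℕ) : ℝ) *
        (C * (γ * ((F.L : ℝ)⁻¹) ^ K)⁻¹ ^ A * (R * (F.L : ℝ) ^ j) ^ A *
          Real.exp (-(κ₁ * ((j : ℝ) + 1) + (1 + ℓ) ^ 2))) +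
      C' * (γ * ((F.L : ℝ)⁻¹) ^ K)⁻¹ ^ A' * Real.exp (-((c' * (P * Real.exp ℓ / (2 * D * ((j : ℝ) + 1)))) ^ αX)) ≤
      288 * C * R ^ (A + 2) * (F.L : ℝ) ^ (3 * F.m) * β ^ (A + 3) * Real.exp (-((1 + ℓ) ^ 2)) +
        C' * Real.exp (2 + 8 / ((c' / (2 * D)) ^ αX / 2 * αX ^ 3 / 6) ^ 2) * β ^ A' * Real.exp (-((1 + ℓ) ^ 2)) :=
    add_le_add ((mul_le_mul_of_nonneg_right hcount hB0).trans h1) h2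
  refine hsum.trans ?_
  -- merge the powers of `β ≥ 1`
  have hβa : β ^ (A + 3) ≤ β ^ (A + 3 + A') := pow_le_pow_right₀ hβ1 (by omega)
  have hβb : β ^ A' ≤ β ^ (A + 3 + A') := pow_le_pow_right₀ hβ1 (by omega)
  have hK1 : 0 ≤ 288 * C * R ^ (A + 2) * (F.L : ℝ) ^ (3 * F.m) := by positivity
  have hK2 : 0 ≤ C' * Real.exp (2 + 8 / ((c' / (2 * D)) ^ αX / 2 * αX ^ 3 / 6) ^ 2) := by positivity
  have hE0 : 0 ≤ Real.exp (-((1 + ℓ) ^ 2)) := Real.exp_nonneg _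
  calc 288 * C * R ^ (A + 2) * (F.L : ℝ) ^ (3 * F.m) * β ^ (A + 3) * Real.exp (-((1 + ℓ) ^ 2)) +
        C' * Real.exp (2 + 8 / ((c' / (2 * D)) ^ αX / 2 * αX ^ 3 / 6) ^ 2) * β ^ A' * Real.exp (-((1 + ℓ) ^ 2))
      ≤ 288 * C * R ^ (A + 2) * (F.L : ℝ) ^ (3 * F.m) * β ^ (A + 3 + A') * Real.exp (-((1 + ℓ) ^ 2)) +
        C' * Real.exp (2 + 8 / ((c' / (2 * D)) ^ αX / 2 * αX ^ 3 / 6) ^ 2) * β ^ (A + 3 + A') *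
          Real.exp (-((1 + ℓ) ^ 2)) :=
        add_le_add (mul_le_mul_of_nonneg_right (mul_le_mul_of_nonneg_left hβa hK1) hE0)
          (mul_le_mul_of_nonneg_right (mul_le_mul_of_nonneg_left hβb hK2) hE0)
    _ = (288 * C * R ^ (A + 2) * (F.L : ℝ) ^ (3 * F.m) +
          C' * Real.exp (2 + 8 / ((c' / (2 * D)) ^ αX / 2 * αX ^ 3 / 6) ^ 2)) * β ^ (A + 3 + A') *
        Real.exp (-((1 + ℓ) ^ 2)) := by ring

end OffSliver

end Summit.QuantumFields.YangMills.Theorems.RandomisedStokesChaos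

end
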